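import Literature.AnabelianGeometry.SemiGraphs.MetabelianLeafStarLevels
import HarnessLib

/-!
# Compatible open normal LEVELS of the rayless counter-carrier `𝒢⋆(p)` («RAYLESS-STAR·CIV-NEG», brick S4,
# part 2): the LEAF levels

Mochizuki, *Semi-graphs of anabelioids*, Publ. RIMS **42** (2006), Def. 2.3 (i)–(iii) pp. 24–25
[cite: MochizukiSemiAnbd2006, Def 2.3 pp.24-25]; [cite: DixonEtAl1999, Prop 1.6].

PROOF/DEFINITION file (abc-iut cell, layer L3, row «RAYLESS-STAR·CIV-NEG», seat abc-iut-L3-t8 gen 6),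
companion of `MetabelianLeafStarLevels.lean`: for the leaf `Iw.Leaf n = ℤ_p ⋊ ⟨1 + p^{n+1}⟩‾` of `𝒢⋆(p)` and a
bound `M` and an EDGE level `W ≤ ℤ_p` (`edgeLevel p M` for quasi-coherence, `p^e ℤ_p` for elevation), the LEAF
level `Iw.leafLevel W n M = ker(φ_{n,M,W})` of the homomorphism
`φ_{n,M,W} : Leaf n → P_M × ℤ_p/W`, `(a, u) ↦ ((a, u) mod p^M, log_{u_n}(u) mod W)`
(`Iw.logHom n` the `u_n`-logarithm, inverse of abc-iut's `IwU.zpowGen n`): normal and open, of index bounded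
UNIFORMLY in `n` when `W` is open (`leafLevel_index_le`), pulled back by the leaf gluing `Iw.lowHom n` to
EXACTLY `W` when `W ⊆ p^M ℤ_p` (`comap_lowHom_leafLevel`; the key is `u_n^{p^M t} ≡ 1 (mod p^{n+M+1})`), and then
fixing every finite continuous `Leaf n`-set with at most `M` points (`leafLevel_fixes`).  No named fact; no side taken on
[IUTchIII] Cor 3.12.
-/

noncomputable section

open scoped Pointwise
open Topology Multiplicative Filter

namespace Literature.AnabelianGeometry.SemiGraphs

open IwahoriWitness

variable {p : ℕ} [hp : Fact p.Prime]

/-! ## 4. The LEAF levels -/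

namespace Iw

/-- The `u_n`-logarithm: the inverse `C_n ≃ ℤ_p` of the `ℤ_p`-exponential `zpowGen n`.
[cite: RibesZalesskii2010, §4.1] -/
def logC (n : ℕ) : ↥(IwU.C (p := p) n) ≃* Multiplicative ℤ_[p] :=
  ((MonoidHom.ofInjective (IwU.zpowGen_injective (p := p) n)).trans
    (MulEquiv.subgroupCongr (IwU.range_zpowGen (p := p) n))).symm

/-- `logC n (u_n^t) = t`. [cite: RibesZalesskii2010, §4.1] -/
@[simp] theorem logC_zpowGen (n : ℕ) (t : Multiplicative ℤ_[p]) :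
    logC (p := p) n ⟨IwU.zpowGen n t, IwU.zpowGen_mem_C n t⟩ = t := by
  apply (logC (p := p) n).symm.injective
  rw [MulEquiv.symm_apply_apply]
  rfl

/-- `u_n ^ (logC n u) = u`. [cite: RibesZalesskii2010, §4.1] -/
theorem zpowGen_logC (n : ℕ) (u : ↥(IwU.C (p := p) n)) : IwU.zpowGen n (logC n u) = u := by
  obtain ⟨u, hu⟩ := u
  rw [← IwU.range_zpowGen] at hu
  obtain ⟨t, rfl⟩ := hu
  exact congrArg (IwU.zpowGen n) (logC_zpowGen n t)

/-- `logC n` is continuous (inverse of a continuous bijection from the compact `ℤ_p` onto the Hausdorff `C_n`).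
[cite: RibesZalesskii2010, §4.1] -/
theorem continuous_logC (n : ℕ) : Continuous (logC (p := p) n) := by
  haveI : CompactSpace (Multiplicative ℤ_[p]) := inferInstanceAs (CompactSpace ℤ_[p])
  have hc : Continuous (logC (p := p) n).symm := by
    change Continuous fun t => (⟨IwU.zpowGen n t, IwU.zpowGen_mem_C n t⟩ : ↥(IwU.C (p := p) n))
    exact (IwU.zpowGen (p := p) n).continuous.subtype_mk _
  exact Continuous.continuous_symm_of_equiv_compact_to_t2 (f := (logC (p := p) n).symm.toEquiv) hc

/-- The projection `Leaf n → C_n`, `(a, u) ↦ u`. [cite: MochizukiSemiAnbd2006, §2 p.23] -/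
def projC (n : ℕ) : Leaf (p := p) n →* ↥(IwU.C (p := p) n) where
  toFun x := ⟨⟨(x : Iw p).s⟩, (mem_leaf_iff n _).1 x.2⟩
  map_one' := by ext; rfl
  map_mul' _ _ := by ext; rfl

/-- The `u_n`-logarithm of the unit coordinate: `Leaf n → ℤ_p`. [cite: RibesZalesskii2010, §4.1] -/
def logHom (n : ℕ) : Leaf (p := p) n →* Multiplicative ℤ_[p] := (logC n).toMonoidHom.comp (projC n)

/-- `logHom n` is continuous. [cite: RibesZalesskii2010, §4.1] -/
theorem continuous_logHom (n : ℕ) : Continuous (logHom (p := p) n) := by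
  refine (continuous_logC n).comp ?_
  exact (((IwU.continuous_mk_iff (p := p)).2 (continuous_s.comp continuous_subtype_val))).subtype_mk _

/-- `logHom n (lowHom n t) = t`. [cite: RibesZalesskii2010, §4.1] -/
@[simp] theorem logHom_lowHom (n : ℕ) (t : Multiplicative ℤ_[p]) : logHom (p := p) n (lowHom n t) = t := by
  change logC n ⟨⟨(bHom 0 (IwU.zpowGen n t)).s⟩, _⟩ = t
  exact logC_zpowGen n t

/-- `u_n ^ (logHom n x)` is the unit coordinate of `x`. [cite: RibesZalesskii2010, §4.1] -/
theorem zpowGen_logHom (n : ℕ) (x : Leaf (p := p) n) : IwU.zpowGen n (logHom n x) = ⟨(x : Iw p).s⟩ :=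
  zpowGen_logC n (projC n x)

/-- The translation embedding `ℤ_p → Leaf n`, `a ↦ (a, 0)`. [cite: MochizukiSemiAnbd2006, §2 p.23] -/
def translHom (n : ℕ) : Multiplicative ℤ_[p] →* Leaf (p := p) n where
  toFun c := ⟨⟨c.toAdd, 0⟩, by rw [mem_leaf_iff]; exact (IwU.C n).one_mem⟩
  map_one' := by ext1; rfl
  map_mul' x y := by ext1; ext <;> simp [w]

/-- Every element of the leaf is a translation times a torus element: `(a, u) = (a, 0)·(0, u)`.
[cite: MochizukiSemiAnbd2006, §2 p.23] -/
theorem translHom_mul_lowHom (n : ℕ) (x : Leaf (p := p) n) :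
    translHom n (ofAdd (x : Iw p).a) * lowHom n (logHom n x) = x := by
  ext1
  change (⟨(x : Iw p).a, 0⟩ : Iw p) * bHom 0 (IwU.zpowGen n (logHom n x)) = (x : Iw p)
  rw [zpowGen_logHom]
  ext <;> simp [w]

section LeafLevel

variable (W : Subgroup (Multiplicative ℤ_[p]))

/-- **The leaf level homomorphism** `φ_{n,M,W} : Leaf n → P_M × ℤ_p/W` for an edge level `W ≤ ℤ_p`.
[cite: MochizukiSemiAnbd2006, Def 2.3(iii) p.25] -/
def leafLevelHom (n M : ℕ) : Leaf (p := p) n →* IwMod p M × (Multiplicative ℤ_[p] ⧸ W) :=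
  ((toMod M).comp (Leaf (p := p) n).subtype).prod ((QuotientGroup.mk' W).comp (logHom n))

/-- **The leaf level** `leafLevel W n M := ker φ_{n,M,W}`. [cite: MochizukiSemiAnbd2006, Def 2.3(iii) p.25] -/
def leafLevel (n M : ℕ) : Subgroup (Leaf (p := p) n) := (leafLevelHom W n M).ker

/-- Membership in the leaf level: in the level-`M` box of `P` and with `u_n`-logarithm in `W`.
[cite: MochizukiSemiAnbd2006, Def 2.3(iii) p.25] -/
theorem mem_leafLevel_iff (n M : ℕ) (x : Leaf (p := p) n) :
    x ∈ leafLevel W n M ↔ toMod M (x : Iw p) = 1 ∧ logHom n x ∈ W := by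
  rw [leafLevel, MonoidHom.mem_ker, leafLevelHom, MonoidHom.prod_apply, Prod.mk_eq_one,
    MonoidHom.comp_apply, MonoidHom.comp_apply, QuotientGroup.mk'_apply, QuotientGroup.eq_one_iff]
  rfl

/-- The leaf level is normal. [cite: MochizukiSemiAnbd2006, Def 2.3(iii) p.25] -/
theorem leafLevel_normal (n M : ℕ) : (leafLevel (p := p) W n M).Normal := by
  unfold leafLevel; infer_instance

/-- The leaf level is open when `W` is. [cite: MochizukiSemiAnbd2006, Def 2.3(iii) p.25] -/
theorem isOpen_leafLevel (hWo : IsOpen (W : Set (Multiplicative ℤ_[p]))) (n M : ℕ) :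
    IsOpen (leafLevel W n M : Set (Leaf (p := p) n)) := by
  have hset : (leafLevel W n M : Set (Leaf (p := p) n)) =
      (fun x : Leaf (p := p) n => (x : Iw p)) ⁻¹' ((toMod (p := p) M).ker : Set (Iw p)) ∩
        (logHom n) ⁻¹' (W : Set (Multiplicative ℤ_[p])) := by
    ext x
    rw [SetLike.mem_coe, mem_leafLevel_iff]
    rfl
  rw [hset]
  exact ((isOpen_ker_toMod (n := M)).preimage continuous_subtype_val).inter
    (hWo.preimage (continuous_logHom n))

/-- The leaf levels have index bounded UNIFORMLY in `n` (by the order of the fixed finite target), when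
`W` is open. [cite: MochizukiSemiAnbd2006, Def 2.3(i) p.24] -/
theorem leafLevel_index_le (hWo : IsOpen (W : Set (Multiplicative ℤ_[p]))) (n M : ℕ) :
    (leafLevel W n M).index ≠ 0 ∧ (leafLevel (p := p) W n M).index ≤
      Nat.card (IwMod p M × (Multiplicative ℤ_[p] ⧸ W)) := by
  haveI : CompactSpace (Multiplicative ℤ_[p]) := inferInstanceAs (CompactSpace ℤ_[p])
  haveI : Finite (Multiplicative ℤ_[p] ⧸ W) := Subgroup.quotient_finite_of_isOpen _ hWo
  rw [leafLevel, Subgroup.index_ker]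
  exact ⟨Nat.card_pos.ne', Nat.card_le_card_of_injective _ Subtype.val_injective⟩

/-- **Compatibility at the leaf**: if `W ⊆ p^M ℤ_p`, the leaf gluing `lowHom n` pulls the leaf level back to
EXACTLY `W` (`u_n^{p^M t'} ≡ 1 (mod p^{n+M+1})` kills the `P_M`-condition). [cite: MochizukiSemiAnbd2006, Def 2.3(iii) p.25] -/
theorem comap_lowHom_leafLevel {M : ℕ} (hWM : ∀ t ∈ W, (p : ℤ_[p]) ^ M ∣ t.toAdd) (n : ℕ) :
    (leafLevel W n M).comap (lowHom (p := p) n).toMonoidHom = W := by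
  ext t
  rw [Subgroup.mem_comap, show (lowHom (p := p) n).toMonoidHom t = lowHom n t from rfl, mem_leafLevel_iff,
    logHom_lowHom]
  constructor
  · exact fun h => h.2
  · intro ht
    refine ⟨?_, ht⟩
    obtain ⟨t', ht'⟩ := hWM t ht
    have hU : IwU.toMod M (IwU.zpowGen (p := p) n t) = 1 := by
      have h := IwU.toMod_zpowGen_eq_one (p := p) n M t'
      rw [← ht', ofAdd_toAdd] at h
      exact IwU.toMod_eq_one_mono (Nat.le_add_left M n) _ h
    rw [IwU.toMod_eq_one_iff] at hU
    rw [coe_lowHom, toMod_eq_one_iff, bHom_a, bHom_s, zero_mul, norm_zero]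
    exact ⟨zpow_nonneg (by exact_mod_cast hp.out.pos.le) _, hU⟩

/-- **The leaf level fixes every finite continuous `Leaf n`-set with at most `M` points** when
`W ⊆ p^M ℤ_p`: its elements are `(p^M a', 0)·(0, u_n^{t})` with `t ∈ W`, and a point stabiliser pulled back to
`ℤ_p` along the translation / torus embedding has index `≤ M`, hence contains `p^M ℤ_p`.
[cite: DixonEtAl1999, Prop 1.6] -/
theorem leafLevel_fixes {M : ℕ} (hWM : ∀ t ∈ W, (p : ℤ_[p]) ^ M ∣ t.toAdd) (n : ℕ)
    (X : BTemp (Leaf (p := p) n)) [Finite X.obj.V] (hX : Nat.card X.obj.V ≤ M)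
    {g : Leaf (p := p) n} (hg : g ∈ leafLevel W n M) (x : X.obj.V) : X.obj.ρ g x = x := by
  obtain ⟨hg1, hg2⟩ := (mem_leafLevel_iff W n M g).1 hg
  obtain ⟨hSo, hS0, hSM⟩ := stab_mem_openSubgroupsIndexLE X x hX
  -- translation part
  have ha : (p : ℤ_[p]) ^ M ∣ (g : Iw p).a := by
    rw [toMod_eq_one_iff, PadicInt.norm_le_pow_iff_mem_span_pow] at hg1
    exact Ideal.mem_span_singleton.mp hg1.1
  obtain ⟨a', ha'⟩ := ha
  have h1 : translHom n (ofAdd (g : Iw p).a) ∈ BTemp.stab X x := by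
    have h := PadicIntLevels.ofAdd_pow_mul_mem_comap (translHom (p := p) n) hS0.ne' hSM a'
    rw [← ha'] at h
    exact h
  -- torus part
  obtain ⟨t', ht'⟩ := hWM _ hg2
  have h2 : lowHom n (logHom n g) ∈ BTemp.stab X x := by
    have h := PadicIntLevels.ofAdd_pow_mul_mem_comap (lowHom (p := p) n).toMonoidHom hS0.ne' hSM t'
    rw [← ht', ofAdd_toAdd] at h
    exact h
  have h12 : translHom n (ofAdd (g : Iw p).a) * lowHom n (logHom n g) ∈ BTemp.stab X x :=
    (BTemp.stab X x).mul_mem h1 h2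
  rw [translHom_mul_lowHom] at h12
  exact h12

end LeafLevel

end Iw

end Literature.AnabelianGeometry.SemiGraphs

end
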